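import Literature.AlgebraicGeometry.HodgeTheory.HodgeGenericQbarDescentFiniteMonodromyInputs
import Literature.AlgebraicGeometry.AbelianSchemes.AbelianSchemeOverBase
import Literature.AlgebraicGeometry.Motives.AbelianVarietyBaseChange
import HarnessLib

/-!
# The total space of a pulled-back abelian scheme is quasi-projective (E6-Π §2: the `hqp` input for pulled-back families)

Topic `Literature/AlgebraicGeometry/AbelianSchemes`, namespace `Literature.AlgebraicGeometry.AbelianSchemes.AbelianSchemeOver`.
THEOREMS ONLY (no definition, no named fact, no instance, no notation, no `sorry`).  Cell hodgecm-mathlib (D-0151), P6 door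
(E), gap (g2) of LEAD F0P6-plan (g2) 22:26:59Z ∕ E6 owner A-p06 (g32) 22:26:19Z («composition ∕ base-change closure of
quasi-projectivity»), sequel of ★ E6-Π `AbelianSchemeTotalSpaceSmoothProjective.isSmoothProjective_total` (p847019), whose
hypothesis `hqp : IsQuasiProjectiveOver (Over.mk (A.X.hom ≫ S.hom))` it discharges for PULLED-BACK families — in particular for
the E6 closer's tuple `𝓜.univ.baseChange (ε.left ≫ pullback.fst 𝓜.M.hom (bcSpec ℚ Fᵢ))` from (F-c″) «the universal total space
is quasi-projective over `ℚ`».  HC_CM is proved only modulo the printed citations until rung 0 closes; this file is generic and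
changes no count.

MATHEMATICS ([Hartshorne1977] II §4 p. 103, Cor. 4.6, Ex. 4.9 (Segre); [GortzWedhorn2020] (4.7) base change): the total space of
`A ×_S S′ → S′ → Spec k` is the fibre product `T ×_S S′` of the total space `T = (A → S → Spec k)` with `S′` over the separated
`S`, a closed subscheme of `T ×_k S′`, hence quasi-projective when `T` and `S′` are (★
`HodgeTheory.isQuasiProjectiveOver_familyPullback_of_isSeparated`); across a field extension `k → K` one first base-changes the
total space (★ `IsQuasiProjectiveOver.baseChangeHom`) and re-brackets the fibre products (Mathlib `pullbackRightPullbackFstIso`,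
`pullbackLeftPullbackSndIso`).
* §1 `isQuasiProjectiveOver_total_baseChange` — same field: `A : AbelianSchemeOver S.left`, `g : S′ ⟶ S` (`S` separated over
  `k`), total space of `A` and `S′` quasi-projective ⇒ total space of `A.baseChange g.left` quasi-projective over `k`.
* §2 `isQuasiProjectiveOver_total_baseChange_field` — the universal family read over `K ⊇ k`: total space of
  `A.baseChange (pullback.fst M.hom (bcSpec k K))` (an abelian scheme over `M_K = (Motives.baseChange k K).obj M`) is quasi-projective over `K`.
* §3 HEAD **`isQuasiProjectiveOver_total_baseChange_of_tower`** — the E6 shape: for `ε : X ⟶ (Motives.baseChange k K).obj M` (`X` a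
  quasi-projective `K`-scheme, `M` separated over `k`), the total space of `A.baseChange (ε.left ≫ pullback.fst M.hom (bcSpec k K))`
  over `K` is quasi-projective.

## References
* [Hartshorne1977] R. Hartshorne, *Algebraic Geometry*, GTM 52 (1977), II §4 (p. 103), Cor. 4.6, Ex. 4.9.
* [GortzWedhorn2020] U. Görtz, T. Wedhorn, *Algebraic Geometry I*, 2nd ed. (2020), Section (4.7) (pp. 107–108).
-/

set_option autoImplicit false

open CategoryTheory CategoryTheory.Limits AlgebraicGeometry

universe u

noncomputable section

namespace Literature.AlgebraicGeometry.AbelianSchemes.AbelianSchemeOver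

open Literature.AlgebraicGeometry.Motives (SchemeOver baseChangeHom familyPullback)
open Literature.AlgebraicGeometry.Motives.AbelianVariety (bcSpec)
open Literature.AlgebraicGeometry.HodgeTheory (IsQuasiProjectiveOver isQuasiProjectiveOver_familyPullback_of_isSeparated
  isQuasiProjectiveOver_of_isClosedImmersion_of_field)

variable {k : Type u} [Field k]

/-! ### §1 Same base field -/

/-- **The total space of a base-changed abelian scheme is quasi-projective** (same field): for `A → S` with total space
`A → S → Spec k` quasi-projective over `k`, `S` separated over `k`, and `g : S′ → S` a `k`-morphism from a quasi-projective `S′`,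
the total space `A ×_S S′ → S′ → Spec k` of `A.baseChange g.left` is quasi-projective over `k` (it is `T ×_S S′`, ★
`isQuasiProjectiveOver_familyPullback_of_isSeparated`). [cite: Hartshorne1977, II Cor. 4.6 and §4 p. 103]
[cite: GortzWedhorn2020, Section (4.7) (pp. 107–108)] -/
theorem isQuasiProjectiveOver_total_baseChange {S S' : SchemeOver k} (A : AbelianSchemeOver S.left) (g : S' ⟶ S)
    [IsSeparated S.hom] (hA : IsQuasiProjectiveOver (Over.mk (A.X.hom ≫ S.hom) : SchemeOver k))
    (hS' : IsQuasiProjectiveOver S') :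
    IsQuasiProjectiveOver (Over.mk ((A.baseChange g.left).X.hom ≫ S'.hom) : SchemeOver k) := by
  let π : (Over.mk (A.X.hom ≫ S.hom) : SchemeOver k) ⟶ S := Over.homMk A.X.hom rfl
  have h := isQuasiProjectiveOver_familyPullback_of_isSeparated π g hA hS'
  -- the two `k`-structures on `A ×_S S'` (through `A` or through `S'`) agree
  have heq : (Over.mk ((A.baseChange g.left).X.hom ≫ S'.hom) : SchemeOver k) = familyPullback π g := by
    change Over.mk (pullback.snd A.X.hom g.left ≫ S'.hom) = Over.mk (pullback.fst A.X.hom g.left ≫ A.X.hom ≫ S.hom)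
    rw [← Over.w g, pullback.condition_assoc]
  rw [heq]
  exact h

/-! ### §2 Across a field extension: the universal family read over `K` -/

/-- **Base change of the total space along `k → K`**: for an abelian scheme `A → M` over a `k`-scheme `M` whose total space is
quasi-projective over `k`, the abelian scheme `A.baseChange (pullback.fst M.hom (bcSpec k K))` over `M_K` has total space
`A ×_M M_K = (A → Spec k) ×_k Spec K` quasi-projective over `K` (★ `IsQuasiProjectiveOver.baseChangeHom` + the re-bracketing
`pullbackRightPullbackFstIso`). [cite: Hartshorne1977, II §4 p. 103] [cite: GortzWedhorn2020, Section (4.7) (pp. 107–108)] -/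
theorem isQuasiProjectiveOver_total_baseChange_field {K : Type u} [Field K] [Algebra k K] {M : SchemeOver k}
    (A : AbelianSchemeOver M.left) (hA : IsQuasiProjectiveOver (Over.mk (A.X.hom ≫ M.hom) : SchemeOver k)) :
    IsQuasiProjectiveOver (Over.mk ((A.baseChange (pullback.fst M.hom (bcSpec k K))).X.hom ≫
      ((Motives.baseChange k K).obj M).hom) : SchemeOver K) := by
  have h1 : IsQuasiProjectiveOver ((baseChangeHom (algebraMap k K)).obj (Over.mk (A.X.hom ≫ M.hom) : SchemeOver k)) :=
    hA.baseChangeHom (algebraMap k K)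
  -- `A ×_M (M ×_k K) ≅ (A → Spec k) ×_k K` over `K`
  let c : (Over.mk ((A.baseChange (pullback.fst M.hom (bcSpec k K))).X.hom ≫ ((Motives.baseChange k K).obj M).hom) : SchemeOver K) ⟶
      (baseChangeHom (algebraMap k K)).obj (Over.mk (A.X.hom ≫ M.hom) : SchemeOver k) :=
    Over.homMk (pullbackRightPullbackFstIso M.hom (bcSpec k K) A.X.hom).hom (by
      change (pullbackRightPullbackFstIso M.hom (bcSpec k K) A.X.hom).hom ≫ pullback.snd (A.X.hom ≫ M.hom) (bcSpec k K) =
        pullback.snd A.X.hom (pullback.fst M.hom (bcSpec k K)) ≫ pullback.snd M.hom (bcSpec k K)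
      exact pullbackRightPullbackFstIso_hom_snd _ _ _)
  haveI : IsClosedImmersion c.left := by
    change IsClosedImmersion (pullbackRightPullbackFstIso M.hom (bcSpec k K) A.X.hom).hom
    infer_instance
  exact isQuasiProjectiveOver_of_isClosedImmersion_of_field c h1

/-! ### §3 HEAD: the E6 shape -/

/-- **(E6-Π §2) THE TOTAL SPACE OF THE FAMILY PULLED BACK ALONG `ε : X → M_K` IS QUASI-PROJECTIVE OVER `K`**: for an abelian scheme
`A → M` over a `k`-scheme `M` separated over `k` with quasi-projective total space (the universal family, (F-c″)), a field
`K ⊇ k`, a quasi-projective `K`-scheme `X` and a `K`-morphism `ε : X ⟶ M_K = (Motives.baseChange k K).obj M`, the total space over `K` of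
`A.baseChange (ε.left ≫ pullback.fst M.hom (bcSpec k K))` — the E6 closer's tuple — is quasi-projective over `K`; with `X`
projective this is the `hqp` input of ★ `isSmoothProjective_total`. (§2, then §1 along `ε` over the separated `M_K`, then the
re-bracketing `pullbackLeftPullbackSndIso`.) [cite: Hartshorne1977, II Cor. 4.6, §4 p. 103 and Ex. 4.9]
[cite: GortzWedhorn2020, Section (4.7) (pp. 107–108)] -/
theorem isQuasiProjectiveOver_total_baseChange_of_tower {K : Type u} [Field K] [Algebra k K] {M : SchemeOver k}
    [IsSeparated M.hom] (A : AbelianSchemeOver M.left)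
    (hA : IsQuasiProjectiveOver (Over.mk (A.X.hom ≫ M.hom) : SchemeOver k)) {X : SchemeOver K}
    (ε : X ⟶ (Motives.baseChange k K).obj M) (hX : IsQuasiProjectiveOver X) :
    IsQuasiProjectiveOver (Over.mk ((A.baseChange (ε.left ≫ pullback.fst M.hom (bcSpec k K))).X.hom ≫ X.hom) :
      SchemeOver K) := by
  -- §2: the family over `M_K`
  have hK := A.isQuasiProjectiveOver_total_baseChange_field (K := K) hA
  -- §1 along `ε` (the base `M_K` is separated over `K`)
  haveI : IsSeparated ((Motives.baseChange k K).obj M).hom := by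
    change IsSeparated (pullback.snd M.hom (bcSpec k K))
    exact MorphismProperty.pullback_snd (P := @IsSeparated) _ _ inferInstance
  have h1 := (A.baseChange (pullback.fst M.hom (bcSpec k K))).isQuasiProjectiveOver_total_baseChange ε hK hX
  -- re-bracket: `A ×_M X ≅ (A ×_M M_K) ×_{M_K} X` over `K`
  let c : (Over.mk ((A.baseChange (ε.left ≫ pullback.fst M.hom (bcSpec k K))).X.hom ≫ X.hom) : SchemeOver K) ⟶
      Over.mk (((A.baseChange (pullback.fst M.hom (bcSpec k K))).baseChange ε.left).X.hom ≫ X.hom) :=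
    Over.homMk (pullbackLeftPullbackSndIso A.X.hom (pullback.fst M.hom (bcSpec k K)) ε.left).inv (by
      change (pullbackLeftPullbackSndIso A.X.hom (pullback.fst M.hom (bcSpec k K)) ε.left).inv ≫
          pullback.snd (pullback.snd A.X.hom (pullback.fst M.hom (bcSpec k K))) ε.left ≫ X.hom =
        pullback.snd A.X.hom (ε.left ≫ pullback.fst M.hom (bcSpec k K)) ≫ X.hom
      exact pullbackLeftPullbackSndIso_inv_snd_snd_assoc _ _ _ _)
  haveI : IsClosedImmersion c.left := by
    change IsClosedImmersion (pullbackLeftPullbackSndIso A.X.hom (pullback.fst M.hom (bcSpec k K)) ε.left).inv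
    infer_instance
  exact isQuasiProjectiveOver_of_isClosedImmersion_of_field c h1

end Literature.AlgebraicGeometry.AbelianSchemes.AbelianSchemeOver

end
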